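import Literature.AnabelianGeometry.EtaleTheta.Discharge.Sec3ConstantLineOfRlfZ
import Literature.AnabelianGeometry.EtaleTheta.Discharge.Sec3FLambdaInvOfRlfWeak
import Literature.AnabelianGeometry.EtaleTheta.Discharge.Sec3Prop34CnstOfRlfQWeak
import HarnessLib

/-!
# [EtTh] Def. 3.6 (i)/(ii)(b): the constant line `ℝ·Φ₀^cnst`, the integrality of `Φ₀^ℝ` and the bracketed
# sentence of Def. 3.6 (ii)(b) AT THE CONSTRUCTED Def. 3.6 (i) data over the WEAK vocabulary
# (`RealifiedDivisorMonoids.ofRlfZWeak` / `ofRlfQWeak` / `ofRlfRWeak`, monoid types `ℤ`, `ℚ`, `ℝ`)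

S. Mochizuki, *The étale theta function …*, Publ. RIMS **45** (2009) [EtTh], §3: Def. 3.3 (iii) PDF p.73,
Prop. 3.4 (ii) p.74, Def. 3.6 (i)–(ii) pp.76–77, Cor. 3.8 p.81 of `paper:doi-10-2977-prims-1234361159`
[cite: MochizukiEtTh2009, Def 3.6 p.76] [cite: MochizukiEtTh2009, Prop 3.4 (ii) p.74]:

> (Prop. 3.4 (ii)) "… natural isomorphisms of monoids `O_L^× ⥲ Ker(B₀(Y^log) → Φ₀^gp(Y^log))`;
> `O_L^▷ ⥲ B₀(Y^log) ×_{Φ₀^gp(Y^log)} Φ₀(Y^log)`; `L^× ⥲ F₀(Y^log)`"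
> (Def. 3.6 (i)) "`Φ₀^ℝ := Φ₀^rlf` … `ℝ·Φ₀^cnst ⊆ (Φ₀^ℝ)^gp` … "; (Def. 3.6 (ii)(b), bracketed) "[so the image of
> `F(A)` in `(Φ^{bs-fld})^gp(A)` contains a nonzero element of `Φ^{bs-fld}(A)`]".

WEAK-VOCABULARY TWIN of `Discharge/Sec3ConstantLineOfRlfZ.lean` + `Discharge/Sec3ConstantLineOfRlfQR.lean`
(abc-iut-w4-d008; the binders `hLine` / `hInt` / `hNZ` of `Discharge/Sec3Def36NonzeroConstants.lean` and row
C38-L05 of the Cor. 3.8 sub-DAG evaluated at the strong constructors `ofRlfZ` / `ofRlfQ` / `ofRlfR`, whose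
hypothesis — the printed Prop. 3.4 (i) for EVERY `Y` — is VACUOUS at the tempered coverings `Ÿ`, `Z_∞` with
infinitely many special-fibre components, cell finding F-L2d2-1).  Here everything is evaluated at
abc-iut-L6-t12's weak constructors `ofRlfZWeak` / `ofRlfQWeak` / `ofRlfRWeak` (`hpf : ∀ Y, IsPerfFactorialCof
(Φ₀ Y)`, abc-iut-L2-t3's repaired reading of Prop. 3.4 (i)), over THE weak realification data `realDataWeak =
RealificationData.canonicalWeak` (real powers `IsPerfFactorialWeak.Rlf.rpow`, `RealificationRPowWeak.lean`):

* `ofRlfZWeak_isCancelMul` / `Q` / `R` — **`hInt` holds with NO hypothesis** (`IsPerfFactorialWeak.Rlf.isCancelMul`);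
* `ofRlfZWeak_mem_FΛ_of_divΛ_eq_of` — `hP34Λ` at `ofRlfZWeak` from the typed `B₀`-level Prop. 3.4 (ii) ALONE
  (`RlfEffective.exists_eq_of_weak`);
* `canonicalWeak_rsmul_toRlfGp_of_eq_or`, `ofRlfZWeak_cnstR_subset_line`, **`ofRlfZWeak_line` / `Q` / `R` —
  `hLine` from the ONE `B₀`-level binder `hcyc`** ("the log-divisor of a constant `c ∈ L^× = F₀(Y)` is
  `v_L(c)·div(ϖ_L)`": `∀ Y, ∃ d ∈ Φ₀(Y), ∀ b ∈ F₀(Y), ∃ n : ℤ, div₀(b) = dⁿ`): `ℝ·Φ₀^cnst(Y) = {r • ι(d)}` and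
  `r • ι(d) = [ι(d)^r]` (`r ≥ 0`) or `[ι(d)^{−r}]⁻¹` (`r ≤ 0`);
* **`TemperedFrobenioid.exists_cnstFn_effective_ofRlfZWeak` / `…QWeak`** (mod `dm.Prop34` + `hcyc`),
  **`…_of_inv`** variants (mod `hF₀inv` + `hcyc`, via `Sec3FLambdaInvOfRlfWeak`), **`…RWeak`** (mod `hcyc`
  ALONE: `F₀^ℝ` is a group, `ofRlfRWeak_hFinv`) — the bracketed sentence of Def. 3.6 (ii)(b) (`hNZ` of row
  C38-L05, VERBATIM) for EVERY tempered Frobenioid over the weak constructed data;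
* `TemperedFrobenioid.bsFldPreStepLimitCriterion_ofRlfZWeak` / `…QWeak` / `…RWeak` — row C38-L05 there.
Generic lemmas of the strong files that do not mention the strong constructors (`rsmul_zero_eq_one`, the
`TemperedFrobenioid.exists_cnstFn_effective_of_line(_of_inv)` / `bsFldPreStepLimitCriterion_of(_line)`
derivations of abc-iut-w4-d008 / w5-d124) are consumed BY NAME; nothing is edited or restated.
Seat abc-iut-L6-t12 (gen 4), cell abc-iut, row «§3 WEAK COLUMN at Λ = ℚ/ℝ» piece (W3).  PROOF-ONLY (0 defs).
HONEST FRAMING: refereed pre-IUT material ([EtTh] §3 over [FrdI] §2); nothing here bears on [IUTchIII]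
Cor. 3.12; no statement of the paper is strengthened; typed ≠ proved for the rest of §3.
-/

noncomputable section

namespace Literature.AnabelianGeometry.EtaleTheta

open CategoryTheory Opposite Literature.AlgebraicGeometry.Frobenioids

universe u₀ v₀ u v w

namespace RealifiedDivisorMonoids

variable {D₀ : Type u} [Category.{v} D₀] (dm : DivisorMonoids.{u, v, w} D₀)
  (hpf : ∀ Y : D₀ᵒᵖ, IsPerfFactorialCof (dm.Φ₀.obj Y))

/-! ### `hInt` at the weak constructors: no hypothesis -/

/-- **`Φ₀^ℝ(Y) = Φ₀(Y)^rlf` is integral** for the weak constructed data `ofRlfZWeak dm hpf`: the WEAK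
realification is a submonoid of `∏_𝔭 ℝ_{≥0}` ([FrdI] Def. 2.4 (i)(c)), hence cancellative
(`IsPerfFactorialWeak.Rlf.isCancelMul`). [cite: MochizukiFrdI2008, Def. 2.4 (i) p.48] -/
theorem ofRlfZWeak_isCancelMul (Y : D₀ᵒᵖ) : IsCancelMul ((ofRlfZWeak dm hpf).ΦR.obj Y) :=
  IsPerfFactorialWeak.Rlf.isCancelMul (hpf Y).weak

/-- `Φ₀^ℝ(Y)` of `ofRlfQWeak dm hpf` is integral (`hInt`, no hypothesis). [cite: MochizukiFrdI2008, Def. 2.4 (i) p.48] -/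
theorem ofRlfQWeak_isCancelMul (Y : D₀ᵒᵖ) : IsCancelMul ((ofRlfQWeak dm hpf).ΦR.obj Y) :=
  IsPerfFactorialWeak.Rlf.isCancelMul (hpf Y).weak

/-- `Φ₀^ℝ(Y)` of `ofRlfRWeak dm hpf` is integral (`hInt`, no hypothesis). [cite: MochizukiFrdI2008, Def. 2.4 (i) p.48] -/
theorem ofRlfRWeak_isCancelMul (Y : D₀ᵒᵖ) : IsCancelMul ((ofRlfRWeak dm hpf).ΦR.obj Y) :=
  IsPerfFactorialWeak.Rlf.isCancelMul (hpf Y).weak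

/-! ### `hP34Λ` at `ofRlfZWeak` from the `B₀`-level Prop. 3.4 (ii) -/

/-- **Prop. 3.4 (ii), second isomorphism, at the weak constructed data of monoid type `ℤ`** (`B₀^ℤ = B₀`,
`F₀^ℤ = F₀`): an element of `B₀(Y)` whose log-divisor becomes effective in `(Φ₀^rlf)^gp(Y)` is already effective in
`Φ₀^gp(Y)` (`RlfEffective.exists_eq_of_weak`), hence constant by the typed `dm.Prop34` — the binder `hP34Λ` at
`ofRlfZWeak dm hpf` from `Prop34` ALONE (abc-iut-L2-t3's `Prop34Cnst.ofRlfZWeak` packages this with `Prop34Cnst₀`).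
[cite: MochizukiEtTh2009, Prop 3.4 (ii) p.74] -/
theorem ofRlfZWeak_mem_FΛ_of_divΛ_eq_of {V : FrdIMonoidStub.{w}} {V₀ : FrdICatStub.{u, v, w} D₀}
    (h34 : dm.Prop34 V V₀) (Y : D₀ᵒᵖ) (b : (ofRlfZWeak dm hpf).BΛ.obj Y) (x : (ofRlfZWeak dm hpf).ΦR.obj Y)
    (hbx : (ofRlfZWeak dm hpf).divΛ Y b = Algebra.GrothendieckGroup.of x) : b ∈ (ofRlfZWeak dm hpf).FΛ Y := by
  obtain ⟨x₀, hx₀, -⟩ := RlfEffective.exists_eq_of_weak (hpf Y).weak (dm.div₀ Y b) x hbx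
  exact h34.mem_F₀_of_div₀_mem Y b x₀ hx₀

/-! ### `hLine` at the weak constructors: the `ℝ`-span of a cyclic group of constants' divisors is a line of
(anti-)effective elements -/

/-- **Real multiples of the class of an element of `Φ(X)` are (anti-)effective** in `(Φ(X)^rlf)^gp`, for THE WEAK
realification data (`Φ(X)` weakly perf-factorial with cofinal perfection): `r • ι^gp[d] = [ι(d)^{r}]` if `r ≥ 0`,
`= [ι(d)^{−r}]⁻¹` if `r ≤ 0` (the `ℝ`-vector-space structure of `(Φ^rlf)^gp` by real powers, [FrdI] Def. 2.4 (i);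
`IsPerfFactorialWeak.Rlf.realSMul_of`). [cite: MochizukiFrdI2008, Def. 2.4 (i) p.48] -/
theorem canonicalWeak_rsmul_toRlfGp_of_eq_or {Φ : D₀ᵒᵖ ⥤ CommMonCat.{w}}
    (hΦ : ∀ Y : D₀ᵒᵖ, IsPerfFactorialCof (Φ.obj Y)) (X : D₀) (r : ℝ) (d : Φ.obj (op X)) :
    ∃ c : (hΦ (op X)).weak.Rlf,
      (RealificationData.canonicalWeak Φ hΦ).rsmul X r
          ((RealificationData.canonicalWeak Φ hΦ).toRlfGp X (Algebra.GrothendieckGroup.of d)) =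
        Algebra.GrothendieckGroup.of c ∨
      (RealificationData.canonicalWeak Φ hΦ).rsmul X r
          ((RealificationData.canonicalWeak Φ hΦ).toRlfGp X (Algebra.GrothendieckGroup.of d)) =
        (Algebra.GrothendieckGroup.of c)⁻¹ := by
  have key : (RealificationData.canonicalWeak Φ hΦ).rsmul X r
      ((RealificationData.canonicalWeak Φ hΦ).toRlfGp X (Algebra.GrothendieckGroup.of d)) =
      Algebra.GrothendieckGroup.of (IsPerfFactorialWeak.Rlf.rpow (hΦ (op X)).weak r.toNNReal
          (((RealificationData.canonicalWeak Φ hΦ).toRlf.app (op X)).hom d)) /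
        Algebra.GrothendieckGroup.of (IsPerfFactorialWeak.Rlf.rpow (hΦ (op X)).weak (-r).toNNReal
          (((RealificationData.canonicalWeak Φ hΦ).toRlf.app (op X)).hom d)) := by
    rw [RealificationData.toRlfGp, MonGp.map_of]
    exact IsPerfFactorialWeak.Rlf.realSMul_of (hΦ (op X)).weak r _
  rcases le_total 0 r with hr | hr
  · refine ⟨IsPerfFactorialWeak.Rlf.rpow (hΦ (op X)).weak r.toNNReal
      (((RealificationData.canonicalWeak Φ hΦ).toRlf.app (op X)).hom d), Or.inl ?_⟩
    rw [Real.toNNReal_of_nonpos (neg_nonpos.mpr hr), IsPerfFactorialWeak.Rlf.rpow_zero, map_one, div_one]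
      at key
    exact key
  · refine ⟨IsPerfFactorialWeak.Rlf.rpow (hΦ (op X)).weak (-r).toNNReal
      (((RealificationData.canonicalWeak Φ hΦ).toRlf.app (op X)).hom d), Or.inr ?_⟩
    rw [Real.toNNReal_of_nonpos hr, IsPerfFactorialWeak.Rlf.rpow_zero, map_one, one_div] at key
    exact key

/-- **The constant line of `ofRlfZWeak` is contained in the real line through `ι(d)`** when the divisors of the
constants `F₀(Y)` are the integer powers of one `d ∈ Φ₀(Y)` (`hd`): `ℝ·Φ₀^cnst(Y) ⊆ {r • ι^gp[d] : r ∈ ℝ}`.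
[cite: MochizukiEtTh2009, Def 3.6 p.76] -/
theorem ofRlfZWeak_cnstR_subset_line (X : D₀) (d : dm.Φ₀.obj (op X))
    (hd : ∀ b ∈ dm.F₀ (op X), ∃ n : ℤ, dm.div₀ (op X) b = Algebra.GrothendieckGroup.of d ^ n)
    {g : Algebra.GrothendieckGroup ((ofRlfZWeak dm hpf).ΦR.obj (op X))}
    (hg : g ∈ (ofRlfZWeak dm hpf).cnstR (op X)) :
    ∃ r : ℝ, g = (realDataWeak dm hpf).rsmul X r
      ((realDataWeak dm hpf).toRlfGp X (Algebra.GrothendieckGroup.of d)) := by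
  -- the line through `δ = ι^gp[d]`, as the range of the homomorphism `r ↦ r • δ`
  let ψ : Multiplicative ℝ →* Algebra.GrothendieckGroup ((realDataWeak dm hpf).rlf.obj (op X)) :=
    { toFun := fun t => (realDataWeak dm hpf).rsmul X (Multiplicative.toAdd t)
        ((realDataWeak dm hpf).toRlfGp X (Algebra.GrothendieckGroup.of d))
      map_one' := by
        change (realDataWeak dm hpf).rsmul X (Multiplicative.toAdd 1) _ = 1
        rw [toAdd_one]
        exact rsmul_zero_eq_one (realDataWeak dm hpf) X _
      map_mul' := fun s t => by
        change (realDataWeak dm hpf).rsmul X (Multiplicative.toAdd (s * t)) _ =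
          (realDataWeak dm hpf).rsmul X (Multiplicative.toAdd s) _ *
            (realDataWeak dm hpf).rsmul X (Multiplicative.toAdd t) _
        rw [toAdd_mul, (realDataWeak dm hpf).rsmul_add] }
  have hψ : ∀ t, ψ t = (realDataWeak dm hpf).rsmul X (Multiplicative.toAdd t)
      ((realDataWeak dm hpf).toRlfGp X (Algebra.GrothendieckGroup.of d)) := fun _ => rfl
  -- (1) `⟨Φ₀^cnst(Y)⟩ ⊆ d^ℤ`
  have h1 : dm.cnstGp.carrier X ≤ Subgroup.zpowers (Algebra.GrothendieckGroup.of d) := by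
    change Subgroup.closure _ ≤ _
    rw [Subgroup.closure_le]
    intro c hc
    have hc' : c ∈ (dm.F₀ (op X)).map (dm.div₀ (op X)) := hc
    obtain ⟨b, hb, rfl⟩ := Submonoid.mem_map.1 hc'
    obtain ⟨n, hn⟩ := hd b hb
    exact Subgroup.mem_zpowers_iff.2 ⟨n, hn.symm⟩
  -- (2) `ℝ·Φ₀^cnst(Y) ⊆ range ψ`
  have h2 : ((realDataWeak dm hpf).realSpan dm.cnstGp).carrier X ≤ ψ.range := by
    change Subgroup.closure _ ≤ _
    rw [Subgroup.closure_le]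
    rintro _ ⟨r, c, hc, rfl⟩
    obtain ⟨k, rfl⟩ := Subgroup.mem_zpowers_iff.1 (h1 hc)
    refine MonoidHom.mem_range.2 ⟨Multiplicative.ofAdd r ^ k, ?_⟩
    rw [map_zpow, hψ, toAdd_ofAdd, map_zpow, map_zpow]
  -- (3) read off `g = r • δ`
  obtain ⟨t, ht⟩ := MonoidHom.mem_range.1 (h2 hg)
  exact ⟨Multiplicative.toAdd t, by rw [← ht, hψ]⟩

/-- **`hLine` at the weak constructed Def. 3.6 (i) data `ofRlfZWeak dm hpf`** (monoid type `ℤ`): if for every `Y`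
the log-divisors of the constants `F₀(Y)` are the integer powers of one element `d ∈ Φ₀(Y)` (`hcyc` — print:
`div₀(c) = v_L(c)·div(ϖ_L)` for `c ∈ L^× ≅ F₀(Y)`, Prop. 3.4 (ii)), then EVERY element of the genuine `ℝ`-span
`ℝ·Φ₀^cnst(Y) ⊆ (Φ₀^rlf)^gp(Y)` is effective or anti-effective — the binder `hLine` of
`TemperedFrobenioid.exists_cnstFn_effective_of_line`, VERBATIM, at `T := ofRlfZWeak dm hpf`.
[cite: MochizukiEtTh2009, Def 3.6 p.76] -/
theorem ofRlfZWeak_line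
    (hcyc : ∀ Y : D₀ᵒᵖ, ∃ d : dm.Φ₀.obj Y, ∀ b ∈ dm.F₀ Y, ∃ n : ℤ,
      dm.div₀ Y b = Algebra.GrothendieckGroup.of d ^ n) :
    ∀ (Y : D₀ᵒᵖ) (g : Algebra.GrothendieckGroup ((ofRlfZWeak dm hpf).ΦR.obj Y)),
      g ∈ (ofRlfZWeak dm hpf).cnstR Y →
      ∃ r : (ofRlfZWeak dm hpf).ΦR.obj Y,
        g = Algebra.GrothendieckGroup.of r ∨ g = (Algebra.GrothendieckGroup.of r)⁻¹ := by
  rintro ⟨X⟩ g hg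
  obtain ⟨d, hd⟩ := hcyc (op X)
  obtain ⟨r, rfl⟩ := ofRlfZWeak_cnstR_subset_line dm hpf X d hd hg
  exact canonicalWeak_rsmul_toRlfGp_of_eq_or hpf X r d

/-- **`hLine` at `ofRlfQWeak dm hpf`** (its `ℝ·Φ₀^cnst` is that of `ofRlfZWeak`, `ofRlfQWeak_cnstR`): from `hcyc`.
[cite: MochizukiEtTh2009, Def 3.6 p.76] -/
theorem ofRlfQWeak_line
    (hcyc : ∀ Y : D₀ᵒᵖ, ∃ d : dm.Φ₀.obj Y, ∀ b ∈ dm.F₀ Y, ∃ n : ℤ,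
      dm.div₀ Y b = Algebra.GrothendieckGroup.of d ^ n) :
    ∀ (Y : D₀ᵒᵖ) (g : Algebra.GrothendieckGroup ((ofRlfQWeak dm hpf).ΦR.obj Y)),
      g ∈ (ofRlfQWeak dm hpf).cnstR Y →
      ∃ r : (ofRlfQWeak dm hpf).ΦR.obj Y,
        g = Algebra.GrothendieckGroup.of r ∨ g = (Algebra.GrothendieckGroup.of r)⁻¹ :=
  ofRlfZWeak_line dm hpf hcyc

/-- **`hLine` at `ofRlfRWeak dm hpf`** (its `ℝ·Φ₀^cnst` is that of `ofRlfZWeak`, `ofRlfRWeak_cnstR`): from `hcyc`.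
[cite: MochizukiEtTh2009, Def 3.6 p.76] -/
theorem ofRlfRWeak_line
    (hcyc : ∀ Y : D₀ᵒᵖ, ∃ d : dm.Φ₀.obj Y, ∀ b ∈ dm.F₀ Y, ∃ n : ℤ,
      dm.div₀ Y b = Algebra.GrothendieckGroup.of d ^ n) :
    ∀ (Y : D₀ᵒᵖ) (g : Algebra.GrothendieckGroup ((ofRlfRWeak dm hpf).ΦR.obj Y)),
      g ∈ (ofRlfRWeak dm hpf).cnstR Y →
      ∃ r : (ofRlfRWeak dm hpf).ΦR.obj Y,
        g = Algebra.GrothendieckGroup.of r ∨ g = (Algebra.GrothendieckGroup.of r)⁻¹ :=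
  ofRlfZWeak_line dm hpf hcyc

end RealifiedDivisorMonoids

/-! ### Def. 3.6 (ii)(b), bracketed sentence, and row C38-L05 for tempered Frobenioids over the weak data -/

namespace TemperedFrobenioid

variable {D₀ : Type u} [Category.{v} D₀] {dm : DivisorMonoids.{u, v, w} D₀}
  {hpf : ∀ Y : D₀ᵒᵖ, IsPerfFactorialCof (dm.Φ₀.obj Y)} {V : FrdIMonoidStub.{w}}
  {V₀ : FrdICatStub.{u, v, w} D₀} {D : Type u₀} [Category.{v₀} D] {VD : FrdICatStub.{u₀, v₀, w} D}

section Z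

variable (C₀ : TemperedFrobenioid (RealifiedDivisorMonoids.ofRlfZWeak dm hpf) D VD)

/-- **Def. 3.6 (ii)(b), bracketed sentence ("the image of `F(A) → (Φ^{bs-fld})^gp(A)` contains a nonzero
element of `Φ^{bs-fld}(A)`"), for EVERY tempered Frobenioid over the weak constructed Def. 3.6 (i) data of monoid
type `ℤ`** — the binder `hNZ` of row C38-L05 VERBATIM — modulo two statements about the Def. 3.3 (iii) data
only: the typed Prop. 3.4 (ii) `dm.Prop34` and `hcyc`. [cite: MochizukiEtTh2009, Def 3.6 p.77] -/
theorem exists_cnstFn_effective_ofRlfZWeak (h34 : dm.Prop34 V V₀)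
    (hcyc : ∀ Y : D₀ᵒᵖ, ∃ d : dm.Φ₀.obj Y, ∀ b ∈ dm.F₀ Y, ∃ n : ℤ,
      dm.div₀ Y b = Algebra.GrothendieckGroup.of d ^ n)
    (A : Dᵒᵖ) :
    ∃ u : ((RealifiedDivisorMonoids.ofRlfZWeak dm hpf).BΛ.obj (C₀.baseOp A) : Type w) ×
        Algebra.GrothendieckGroup (C₀.Φ.carrier A),
      u ∈ C₀.cnstFn A ∧ ∃ Z : C₀.Φ.carrier A, Z ≠ 1 ∧ u.2 = Algebra.GrothendieckGroup.of Z :=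
  C₀.exists_cnstFn_effective_of_line (RealifiedDivisorMonoids.ofRlfZWeak_line dm hpf hcyc)
    (RealifiedDivisorMonoids.ofRlfZWeak_isCancelMul dm hpf)
    (RealifiedDivisorMonoids.ofRlfZWeak_mem_FΛ_of_divΛ_eq_of dm hpf h34) A

/-- **Def. 3.6 (ii)(b), bracketed sentence, over `ofRlfZWeak dm hpf` — variant without Prop. 3.4**: from `hcyc`
and the `B₀`-level inverse-closure `hF₀inv` of `F₀` ("`F₀(Y) ≅ L^×`"; = `hFinv` at `ofRlfZWeak` by
`ofRlfZWeak_hFinv_iff`). [cite: MochizukiEtTh2009, Def 3.6 p.77] -/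
theorem exists_cnstFn_effective_ofRlfZWeak_of_inv
    (hF₀inv : ∀ (Y : D₀ᵒᵖ) (b : dm.B₀.obj Y), b ∈ dm.F₀ Y → ∃ b' ∈ dm.F₀ Y, b' * b = 1)
    (hcyc : ∀ Y : D₀ᵒᵖ, ∃ d : dm.Φ₀.obj Y, ∀ b ∈ dm.F₀ Y, ∃ n : ℤ,
      dm.div₀ Y b = Algebra.GrothendieckGroup.of d ^ n)
    (A : Dᵒᵖ) :
    ∃ u : ((RealifiedDivisorMonoids.ofRlfZWeak dm hpf).BΛ.obj (C₀.baseOp A) : Type w) ×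
        Algebra.GrothendieckGroup (C₀.Φ.carrier A),
      u ∈ C₀.cnstFn A ∧ ∃ Z : C₀.Φ.carrier A, Z ≠ 1 ∧ u.2 = Algebra.GrothendieckGroup.of Z :=
  C₀.exists_cnstFn_effective_of_line_of_inv (RealifiedDivisorMonoids.ofRlfZWeak_line dm hpf hcyc)
    (RealifiedDivisorMonoids.ofRlfZWeak_isCancelMul dm hpf)
    ((RealifiedDivisorMonoids.ofRlfZWeak_hFinv_iff dm hpf).2 hF₀inv) A

/-- **Row C38-L05 of the [EtTh] Cor. 3.8 sub-DAG for tempered Frobenioids over `ofRlfZWeak dm hpf`** (monoid type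
`ℤ`): abc-iut-w5-d124's `bsFldPreStepLimitCriterion_of_line` with `hP34Λ`, `hLine`, `hInt` supplied — modulo
`dm.Prop34`, `hcyc`, and the supremum property `hSup` (G-w5d124-3).  (The tempered Frobenioid `C₀` over the WEAK
data is bound IN the statement, so that it is not textually the strong `…_ofRlfZ`.) [cite: MochizukiEtTh2009, Cor 3.8 p.81] -/
theorem bsFldPreStepLimitCriterion_ofRlfZWeak
    (C₀ : TemperedFrobenioid (RealifiedDivisorMonoids.ofRlfZWeak dm hpf) D VD)
    (hF : PreFrobenioid.IsFrobenioid C₀.toElem) (h34 : dm.Prop34 V V₀)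
    (hcyc : ∀ Y : D₀ᵒᵖ, ∃ d : dm.Φ₀.obj Y, ∀ b ∈ dm.F₀ Y, ∃ n : ℤ,
      dm.div₀ Y b = Algebra.GrothendieckGroup.of d ^ n)
    (hSup : ∀ (W : D) (m : Perfection (C₀.divisorMonoid.obj (op W)))
      (U : Set (Perfection (C₀.divisorMonoid.obj (op W)))),
      U ⊆ C₀.bsFldPf W → U.Nonempty → (∀ u ∈ U, u ∣ m) → ∃ y ∈ C₀.bsFldPf W, (∀ u ∈ U, u ∣ y) ∧ y ∣ m) :
    C₀.BsFldPreStepLimitCriterion (PreFrobenioidData.perfection hF) :=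
  C₀.bsFldPreStepLimitCriterion_of_line hF (RealifiedDivisorMonoids.ofRlfZWeak_mem_FΛ_of_divΛ_eq_of dm hpf h34)
    (RealifiedDivisorMonoids.ofRlfZWeak_line dm hpf hcyc)
    (RealifiedDivisorMonoids.ofRlfZWeak_isCancelMul dm hpf) hSup

end Z

section Q

variable (C₀ : TemperedFrobenioid (RealifiedDivisorMonoids.ofRlfQWeak dm hpf) D VD)

/-- **Def. 3.6 (ii)(b), bracketed sentence, for every tempered Frobenioid over the weak constructed data of
monoid type `ℚ`** (`hNZ` of row C38-L05 VERBATIM), modulo `dm.Prop34` + `hcyc`.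
[cite: MochizukiEtTh2009, Def 3.6 p.77] -/
theorem exists_cnstFn_effective_ofRlfQWeak (h34 : dm.Prop34 V V₀)
    (hcyc : ∀ Y : D₀ᵒᵖ, ∃ d : dm.Φ₀.obj Y, ∀ b ∈ dm.F₀ Y, ∃ n : ℤ,
      dm.div₀ Y b = Algebra.GrothendieckGroup.of d ^ n)
    (A : Dᵒᵖ) :
    ∃ u : ((RealifiedDivisorMonoids.ofRlfQWeak dm hpf).BΛ.obj (C₀.baseOp A) : Type w) ×
        Algebra.GrothendieckGroup (C₀.Φ.carrier A),
      u ∈ C₀.cnstFn A ∧ ∃ Z : C₀.Φ.carrier A, Z ≠ 1 ∧ u.2 = Algebra.GrothendieckGroup.of Z :=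
  C₀.exists_cnstFn_effective_of_line (RealifiedDivisorMonoids.ofRlfQWeak_line dm hpf hcyc)
    (RealifiedDivisorMonoids.ofRlfQWeak_isCancelMul dm hpf)
    (RealifiedDivisorMonoids.Prop34Cnst.ofRlfQWeak_mem_FΛ_of_divΛ_eq_of' h34) A

/-- **Def. 3.6 (ii)(b), bracketed sentence, over `ofRlfQWeak dm hpf` — variant without Prop. 3.4**: from `hcyc`
and the `B₀`-level inverse-closure `hF₀inv` of `F₀` (its perfection `F₀^pf = F₀^ℚ` is then inverse-closed,
`ofRlfQWeak_hFinv_of'`). [cite: MochizukiEtTh2009, Def 3.6 p.77] -/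
theorem exists_cnstFn_effective_ofRlfQWeak_of_inv
    (hF₀inv : ∀ (Y : D₀ᵒᵖ) (b : dm.B₀.obj Y), b ∈ dm.F₀ Y → ∃ b' ∈ dm.F₀ Y, b' * b = 1)
    (hcyc : ∀ Y : D₀ᵒᵖ, ∃ d : dm.Φ₀.obj Y, ∀ b ∈ dm.F₀ Y, ∃ n : ℤ,
      dm.div₀ Y b = Algebra.GrothendieckGroup.of d ^ n)
    (A : Dᵒᵖ) :
    ∃ u : ((RealifiedDivisorMonoids.ofRlfQWeak dm hpf).BΛ.obj (C₀.baseOp A) : Type w) ×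
        Algebra.GrothendieckGroup (C₀.Φ.carrier A),
      u ∈ C₀.cnstFn A ∧ ∃ Z : C₀.Φ.carrier A, Z ≠ 1 ∧ u.2 = Algebra.GrothendieckGroup.of Z :=
  C₀.exists_cnstFn_effective_of_line_of_inv (RealifiedDivisorMonoids.ofRlfQWeak_line dm hpf hcyc)
    (RealifiedDivisorMonoids.ofRlfQWeak_isCancelMul dm hpf)
    (RealifiedDivisorMonoids.ofRlfQWeak_hFinv_of' dm hpf hF₀inv) A

/-- **Row C38-L05 over `ofRlfQWeak dm hpf`**: `hP34Λ` from `dm.Prop34` (`Prop34Cnst.ofRlfQWeak_mem_FΛ_of_divΛ_eq_of'`),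
`hLine`/`hInt` from `hcyc`/nothing; `hSup` stays. [cite: MochizukiEtTh2009, Cor 3.8 p.81] -/
theorem bsFldPreStepLimitCriterion_ofRlfQWeak
    (C₀ : TemperedFrobenioid (RealifiedDivisorMonoids.ofRlfQWeak dm hpf) D VD)
    (hF : PreFrobenioid.IsFrobenioid C₀.toElem) (h34 : dm.Prop34 V V₀)
    (hcyc : ∀ Y : D₀ᵒᵖ, ∃ d : dm.Φ₀.obj Y, ∀ b ∈ dm.F₀ Y, ∃ n : ℤ,
      dm.div₀ Y b = Algebra.GrothendieckGroup.of d ^ n)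
    (hSup : ∀ (W : D) (m : Perfection (C₀.divisorMonoid.obj (op W)))
      (U : Set (Perfection (C₀.divisorMonoid.obj (op W)))),
      U ⊆ C₀.bsFldPf W → U.Nonempty → (∀ u ∈ U, u ∣ m) → ∃ y ∈ C₀.bsFldPf W, (∀ u ∈ U, u ∣ y) ∧ y ∣ m) :
    C₀.BsFldPreStepLimitCriterion (PreFrobenioidData.perfection hF) :=
  C₀.bsFldPreStepLimitCriterion_of_line hF
    (RealifiedDivisorMonoids.Prop34Cnst.ofRlfQWeak_mem_FΛ_of_divΛ_eq_of' h34)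
    (RealifiedDivisorMonoids.ofRlfQWeak_line dm hpf hcyc)
    (RealifiedDivisorMonoids.ofRlfQWeak_isCancelMul dm hpf) hSup

end Q

section R

variable (C₀ : TemperedFrobenioid (RealifiedDivisorMonoids.ofRlfRWeak dm hpf) D VD)

/-- **Def. 3.6 (ii)(b), bracketed sentence, for every tempered Frobenioid over the weak constructed data of
monoid type `ℝ`** (`hNZ` of row C38-L05 VERBATIM), modulo `hcyc` ALONE — no Prop. 3.4 input: the third input is
the inverse-closure of `F₀^ℝ`, which holds by construction (`ofRlfRWeak_hFinv`).
[cite: MochizukiEtTh2009, Def 3.6 p.77] -/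
theorem exists_cnstFn_effective_ofRlfRWeak
    (hcyc : ∀ Y : D₀ᵒᵖ, ∃ d : dm.Φ₀.obj Y, ∀ b ∈ dm.F₀ Y, ∃ n : ℤ,
      dm.div₀ Y b = Algebra.GrothendieckGroup.of d ^ n)
    (A : Dᵒᵖ) :
    ∃ u : ((RealifiedDivisorMonoids.ofRlfRWeak dm hpf).BΛ.obj (C₀.baseOp A) : Type w) ×
        Algebra.GrothendieckGroup (C₀.Φ.carrier A),
      u ∈ C₀.cnstFn A ∧ ∃ Z : C₀.Φ.carrier A, Z ≠ 1 ∧ u.2 = Algebra.GrothendieckGroup.of Z :=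
  C₀.exists_cnstFn_effective_of_line_of_inv (RealifiedDivisorMonoids.ofRlfRWeak_line dm hpf hcyc)
    (RealifiedDivisorMonoids.ofRlfRWeak_isCancelMul dm hpf)
    (RealifiedDivisorMonoids.ofRlfRWeak_hFinv dm hpf) A

/-- **Row C38-L05 over `ofRlfRWeak dm hpf`**: `hNZ` supplied from `hcyc`; the criterion's own `hP34Λ` binder and
`hSup` stay (as in the strong `bsFldPreStepLimitCriterion_ofRlfR`). [cite: MochizukiEtTh2009, Cor 3.8 p.81] -/
theorem bsFldPreStepLimitCriterion_ofRlfRWeak (hF : PreFrobenioid.IsFrobenioid C₀.toElem)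
    (hP34Λ : ∀ (Y : D₀ᵒᵖ) (b : (RealifiedDivisorMonoids.ofRlfRWeak dm hpf).BΛ.obj Y)
      (r : (RealifiedDivisorMonoids.ofRlfRWeak dm hpf).ΦR.obj Y),
      (RealifiedDivisorMonoids.ofRlfRWeak dm hpf).divΛ Y b = Algebra.GrothendieckGroup.of r →
        b ∈ (RealifiedDivisorMonoids.ofRlfRWeak dm hpf).FΛ Y)
    (hcyc : ∀ Y : D₀ᵒᵖ, ∃ d : dm.Φ₀.obj Y, ∀ b ∈ dm.F₀ Y, ∃ n : ℤ,
      dm.div₀ Y b = Algebra.GrothendieckGroup.of d ^ n)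
    (hSup : ∀ (W : D) (m : Perfection (C₀.divisorMonoid.obj (op W)))
      (U : Set (Perfection (C₀.divisorMonoid.obj (op W)))),
      U ⊆ C₀.bsFldPf W → U.Nonempty → (∀ u ∈ U, u ∣ m) → ∃ y ∈ C₀.bsFldPf W, (∀ u ∈ U, u ∣ y) ∧ y ∣ m) :
    C₀.BsFldPreStepLimitCriterion (PreFrobenioidData.perfection hF) :=
  C₀.bsFldPreStepLimitCriterion_of hF hP34Λ (C₀.exists_cnstFn_effective_ofRlfRWeak hcyc) hSup

end R

end TemperedFrobenioid

end Literature.AnabelianGeometry.EtaleTheta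

end
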